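import Literature.MathematicalPhysics.QuantumLattice.DWaveSourceTorusSourcePowerSeries
import Literature.MathematicalPhysics.QuantumLattice.ComplexSourceCumulantBound
import HarnessLib

/-!
# The zero-free complex source disc of the interacting torus at fixed temperature, and its cumulants

Topic `MathematicalPhysics/QuantumLattice`; continuation of `DWaveSourceTorusSourcePowerSeries` (fixed
temperature). There: for `β ≥ 0`, `μ`, `L ≥ 3` and real `|U|, |h| ≤ δ`,
`Z_L(U,h) = Tr e^{-β(H_{L,U,μ} - h(Δ_d + Δ_d†))} = Z₀'(L) exp(Σ_m a_m(L;U) h^m)` with `‖a_m(L;U)‖ ≤ (3/2)L²Aϱ^m`,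
`‖a_m(L;U) - a_m(L;0)‖ ≤ (3/2)L²Aϱ^{m+1}|U|`, `ϱδ ≤ 1/3`. Since `z ↦ Z_L(U,z)` is entire
(`differentiable_partitionFn_sub_smul`) and `z ↦ Z₀' exp(Σ_m a_m z^m)` is holomorphic on `‖z‖ < 3δ`, the identity
theorem continues the representation to COMPLEX sources (`dWaveSourceTorus_complexSourceDisc`):

* **zero-free source disc**: `Z_L(U,z) ≠ 0` for all complex `‖z‖ < 2δ`, all `L ≥ 3` and `|U| ≤ δ` — a disc of
  `L`-independent radius at fixed temperature (the free case is the exact Lee–Yang cone of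
  `DWaveSourceFreeLeeYang`; here the interacting torus, perturbatively);
* **the cumulants**: `(m!)⁻¹ (log Z_L(U,·))⁽ᵐ⁾(0) = a_m(L;U)` for `m ≥ 1`, hence
  `‖(m!)⁻¹(log Z_L)⁽ᵐ⁾(0)‖ ≤ (3/2)L²Aϱ^m` and `‖(m!)⁻¹[(log Z_L(U,·))⁽ᵐ⁾(0) - (log Z_L(0,·))⁽ᵐ⁾(0)]‖ ≤ (3/2)L²Aϱ^{m+1}|U|`:
  every imaginary-time-ordered cumulant of the macroscopic `d`-wave pair field `∫₀^β(Δ_d+Δ_d†)(τ)dτ` is `O(L²)`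
  with geometric growth in the order, and its interaction correction is `O(L²|U|)`, uniformly in the volume;
* `dWaveSourceTorus_pairCumulantBound_fixedT` — the same written in the shape of hypothesis (K) of
  `HubbardSuperconductivity/ThermalWedge` (`…TwSourcedInertnessDiscOfCumulants`), at FIXED `β ≥ 1`:
  `‖(m!)⁻¹(log Z_L)⁽ᵐ⁾(0)‖ ≤ A'(1 + log β)(βL²)(B'β)^{m-2}` (`m ≥ 2`) with `A', B'` depending on `β` — the
  single-scale calibration of (K); its content on the window `β ≤ e^{a/U}` (constants uniform in `β`) is the
  multiscale statement and is NOT asserted here.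

The complex analysis is abstract (`eqOn_mul_cexp_of_real_eq`, `iteratedDeriv_clog_eq_of_eqOn_mul_cexp`,
`iteratedDeriv_tsum_mul_pow_zero`). Everything is PROVED; no definition and no named fact.

## References
* D. Ruelle, *Statistical Mechanics: Rigorous Results* (1969), §4.4 (zeros of `Z` and analyticity of the
  pressure). [cite: Ruelle1969, §4.4]
* G. Benfatto, A. Giuliani, V. Mastropietro, Ann. Henri Poincaré 7 (2006) 809–898, §2, (2.77).
  [cite: BenfattoGiulianiMastropietro2006, (2.77)]
* E. C. Titchmarsh, *The Theory of Functions*, 2nd ed. (1939), §4.1. [cite: Titchmarsh1939, §4.1]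
-/

noncomputable section

open scoped Matrix Matrix.Norms.L2Operator ComplexOrder Nat
open Complex Filter Topology Set Metric
open Literature.Probability.LatticeModels

namespace Literature.MathematicalPhysics.QuantumLattice

/-! ### Power series with geometrically bounded coefficients -/

section PowerSeries

variable {a : ℕ → ℂ} {M ϱ : ℝ}

/-- Termwise bound `‖a_m z^m‖ ≤ M (ϱ‖z‖)^m`. [folklore] -/
theorem norm_mul_pow_le_of_coeff_bound (ha : ∀ m, ‖a m‖ ≤ M * ϱ ^ m) (z : ℂ) (m : ℕ) :
    ‖a m * z ^ m‖ ≤ M * (ϱ * ‖z‖) ^ m := by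
  rw [norm_mul, norm_pow, mul_pow, ← mul_assoc]
  exact mul_le_mul_of_nonneg_right (ha m) (by positivity)

/-- The power series `Σ a_m z^m` converges absolutely for `ϱ‖z‖ < 1` and is bounded by `M/(1 - ϱ‖z‖)` there.
[folklore] -/
theorem norm_tsum_mul_pow_le (hϱ : 0 ≤ ϱ) (ha : ∀ m, ‖a m‖ ≤ M * ϱ ^ m) {z : ℂ}
    (hz : ϱ * ‖z‖ < 1) :
    (Summable fun m => ‖a m * z ^ m‖) ∧ ‖∑' m, a m * z ^ m‖ ≤ M / (1 - ϱ * ‖z‖) := by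
  have hx0 : 0 ≤ ϱ * ‖z‖ := by positivity
  have hgeo : Summable fun m : ℕ => M * (ϱ * ‖z‖) ^ m := (summable_geometric_of_lt_one hx0 hz).mul_left M
  have hs : Summable fun m => ‖a m * z ^ m‖ :=
    Summable.of_nonneg_of_le (fun m => norm_nonneg _) (norm_mul_pow_le_of_coeff_bound ha z) hgeo
  refine ⟨hs, ?_⟩
  calc ‖∑' m, a m * z ^ m‖ ≤ ∑' m, ‖a m * z ^ m‖ := norm_tsum_le_tsum_norm hs
    _ ≤ ∑' m : ℕ, M * (ϱ * ‖z‖) ^ m := Summable.tsum_le_tsum (norm_mul_pow_le_of_coeff_bound ha z) hs hgeo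
    _ = M * ∑' m : ℕ, (ϱ * ‖z‖) ^ m := tsum_mul_left
    _ = M / (1 - ϱ * ‖z‖) := by rw [tsum_geometric_of_lt_one hx0 hz, div_eq_mul_inv]

/-- The power series `Σ a_m z^m` is holomorphic on every disc `‖z‖ < r` with `ϱ r < 1`. [cite: Titchmarsh1939, §4.1] -/
theorem differentiableOn_tsum_mul_pow (hM : 0 ≤ M) (hϱ : 0 ≤ ϱ) (ha : ∀ m, ‖a m‖ ≤ M * ϱ ^ m) {r : ℝ}
    (hr : 0 ≤ r) (hϱr : ϱ * r < 1) :
    DifferentiableOn ℂ (fun z : ℂ => ∑' m, a m * z ^ m) (ball (0 : ℂ) r) := by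
  have hx0 : 0 ≤ ϱ * r := by positivity
  refine differentiableOn_tsum_of_summable_norm ((summable_geometric_of_lt_one hx0 hϱr).mul_left M)
    (fun m => ((differentiable_const _).mul (differentiable_pow m)).differentiableOn) isOpen_ball
    (fun m w hw => ?_)
  have hw' : ‖w‖ ≤ r := (mem_ball_zero_iff.mp hw).le
  calc ‖a m * w ^ m‖ ≤ M * (ϱ * ‖w‖) ^ m := norm_mul_pow_le_of_coeff_bound ha w m
    _ ≤ M * (ϱ * r) ^ m :=
        mul_le_mul_of_nonneg_left (pow_le_pow_left₀ (by positivity) (mul_le_mul_of_nonneg_left hw' hϱ) m) hM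

/-- **Taylor coefficients of a power series**: `(Σ_k a_k z^k)⁽ᵐ⁾(0) = m! · a_m` when `‖a_k‖ ≤ Mϱ^k`.
[cite: Titchmarsh1939, §4.1] -/
theorem iteratedDeriv_tsum_mul_pow_zero (hM : 0 ≤ M) (hϱ : 0 < ϱ) (ha : ∀ m, ‖a m‖ ≤ M * ϱ ^ m) (m : ℕ) :
    iteratedDeriv m (fun z : ℂ => ∑' k, a k * z ^ k) 0 = (m ! : ℂ) * a m := by
  set p : FormalMultilinearSeries ℂ ℂ ℂ := FormalMultilinearSeries.ofScalars ℂ a with hp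
  -- the radius is at least `1/(2ϱ)`
  set r : NNReal := ⟨(2 * ϱ)⁻¹, by positivity⟩ with hr
  have hrle : (r : ENNReal) ≤ p.radius := by
    refine p.le_radius_of_bound M fun n => ?_
    rw [hp, FormalMultilinearSeries.ofScalars_norm]
    have hrn : (r : ℝ) = (2 * ϱ)⁻¹ := rfl
    rw [hrn]
    calc ‖a n‖ * (2 * ϱ)⁻¹ ^ n ≤ M * ϱ ^ n * (2 * ϱ)⁻¹ ^ n :=
          mul_le_mul_of_nonneg_right (ha n) (by positivity)
      _ = M * (1 / 2) ^ n := by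
          rw [mul_assoc, ← mul_pow]
          congr 2
          field_simp
      _ ≤ M * 1 := mul_le_mul_of_nonneg_left (pow_le_one₀ (by norm_num) (by norm_num)) hM
      _ = M := mul_one M
  have hrpos : (0 : ENNReal) < r := by
    have : (0 : NNReal) < r := by
      rw [hr]
      exact_mod_cast (by positivity : (0 : ℝ) < (2 * ϱ)⁻¹)
    exact_mod_cast this
  have hrad : 0 < p.radius := lt_of_lt_of_le hrpos hrle
  have hps := p.hasFPowerSeriesOnBall hrad
  -- the sum of `p` is our series
  have hsum : p.sum = fun z : ℂ => ∑' k, a k * z ^ k := by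
    funext z
    rw [FormalMultilinearSeries.sum]
    refine tsum_congr fun n => ?_
    rw [hp, FormalMultilinearSeries.ofScalars_apply_eq, smul_eq_mul]
  have key := hps.factorial_smul 1 m
  rw [hsum] at key
  rw [iteratedDeriv_eq_iteratedFDeriv, ← key, hp, FormalMultilinearSeries.ofScalars_apply_eq, one_pow,
    smul_eq_mul, mul_one, nsmul_eq_mul]

end PowerSeries

/-! ### Identity theorem from the real axis; Taylor coefficients of `log Z` -/

section Continuation

variable {Z T : ℂ → ℂ} {c : ℂ} {r δ : ℝ}

/-- **Identity theorem from a real segment.** If `Z` is entire, `T` is holomorphic on `‖z‖ < r`, and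
`Z(t) = c · exp(T(t))` for all real `|t| ≤ δ` (`0 < δ`), then `Z = c · exp ∘ T` on the whole disc `‖z‖ < r`.
[cite: Titchmarsh1939, §4.1] -/
theorem eqOn_mul_cexp_of_real_eq (hZ : Differentiable ℂ Z) (hT : DifferentiableOn ℂ T (ball (0 : ℂ) r))
    (hr : 0 < r) (hδ : 0 < δ) (hreal : ∀ t : ℝ, |t| ≤ δ → Z (t : ℂ) = c * exp (T (t : ℂ))) :
    EqOn Z (fun z => c * exp (T z)) (ball (0 : ℂ) r) := by
  have hZa : AnalyticOnNhd ℂ Z (ball (0 : ℂ) r) := hZ.differentiableOn.analyticOnNhd isOpen_ball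
  have hGa : AnalyticOnNhd ℂ (fun z => c * exp (T z)) (ball (0 : ℂ) r) :=
    ((differentiableOn_const c).mul hT.cexp).analyticOnNhd isOpen_ball
  refine hZa.eqOn_of_preconnected_of_frequently_eq hGa (convex_ball (0 : ℂ) r).isPreconnected
    (mem_ball_self hr) ?_
  rw [Filter.frequently_iff]
  intro U hU
  obtain ⟨ε, hε, hεU⟩ := Metric.mem_nhdsWithin_iff.mp hU
  set t : ℝ := min (ε / 2) δ with ht
  have htpos : 0 < t := lt_min (by linarith) hδ
  have htε : t < ε := lt_of_le_of_lt (min_le_left _ _) (by linarith)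
  have htδ : t ≤ δ := min_le_right _ _
  refine ⟨(t : ℂ), hεU ⟨?_, ?_⟩, hreal t (by rw [abs_of_pos htpos]; exact htδ)⟩
  · rw [mem_ball_zero_iff, Complex.norm_real, Real.norm_eq_abs, abs_of_pos htpos]; exact htε
  · rw [mem_compl_singleton_iff, Ne, Complex.ofReal_eq_zero]; exact htpos.ne'

/-- **The Taylor coefficients of `log Z` at `0` are those of `T`.** If `Z` is entire with `Z 0` in the slit
plane, `T` is holomorphic on `‖z‖ < r` and `Z = c · exp ∘ T` there, then `(log ∘ Z)⁽ⁿ⁾(0) = T⁽ⁿ⁾(0)` for every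
`n ≥ 1` (near `0`, `log Z - T` is a holomorphic logarithm of the constant `c`, hence has zero derivative).
[cite: Ruelle1969, §4.4] -/
theorem iteratedDeriv_clog_eq_of_eqOn_mul_cexp (hZ : Differentiable ℂ Z) (h0 : Z 0 ∈ slitPlane)
    (hT : DifferentiableOn ℂ T (ball (0 : ℂ) r)) (hr : 0 < r)
    (heq : EqOn Z (fun z => c * exp (T z)) (ball (0 : ℂ) r)) {n : ℕ} (hn : 1 ≤ n) :
    iteratedDeriv n (fun z => log (Z z)) 0 = iteratedDeriv n T 0 := by
  -- a ball on which `Z` stays in the slit plane and `T` is holomorphic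
  have hpre : Z ⁻¹' slitPlane ∈ 𝓝 (0 : ℂ) :=
    hZ.continuous.continuousAt.preimage_mem_nhds (isOpen_slitPlane.mem_nhds h0)
  obtain ⟨ρ, hρ, hball⟩ := Metric.mem_nhds_iff.mp hpre
  set s : ℝ := min ρ r with hs
  have hspos : 0 < s := lt_min hρ hr
  have hsub1 : ball (0 : ℂ) s ⊆ ball 0 ρ := ball_subset_ball (min_le_left _ _)
  have hsub2 : ball (0 : ℂ) s ⊆ ball 0 r := ball_subset_ball (min_le_right _ _)
  have hc : c ≠ 0 := by
    intro hc0
    have h00 : Z 0 = 0 := by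
      have h := heq (mem_ball_self hr)
      simp only [hc0, zero_mul] at h
      exact h
    exact slitPlane_ne_zero h0 h00
  -- on that ball the derivatives of `log ∘ Z` and `T` agree
  have hderiv : ∀ w ∈ ball (0 : ℂ) s, deriv (fun z => log (Z z)) w = deriv T w := by
    intro w hw
    have hwZ : Z w ∈ slitPlane := hball (hsub1 hw)
    have hTw : DifferentiableAt ℂ T w := hT.differentiableAt (isOpen_ball.mem_nhds (hsub2 hw))
    have hL : HasDerivAt (fun z => log (Z z)) (deriv Z w / Z w) w := (hZ w).hasDerivAt.clog hwZ
    have hTd : HasDerivAt T (deriv T w) w := hTw.hasDerivAt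
    -- `G = log Z - T` has `exp ∘ G = c` near `w`
    have hG : HasDerivAt (fun z => exp (log (Z z) - T z)) (exp (log (Z w) - T w) * (deriv Z w / Z w - deriv T w)) w :=
      (hL.sub hTd).cexp
    have hconst : (fun z => exp (log (Z z) - T z)) =ᶠ[𝓝 w] fun _ => c := by
      filter_upwards [isOpen_ball.mem_nhds hw] with z hz
      have hzZ : Z z ≠ 0 := slitPlane_ne_zero (hball (hsub1 hz))
      rw [exp_sub, exp_log hzZ, heq (hsub2 hz), mul_div_assoc, div_self (exp_ne_zero _), mul_one]
    have hG0 : HasDerivAt (fun z => exp (log (Z z) - T z)) 0 w :=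
      (hasDerivAt_const w c).congr_of_eventuallyEq hconst
    have hzero := hG.unique hG0
    rw [mul_eq_zero] at hzero
    rcases hzero with h | h
    · exact absurd h (exp_ne_zero _)
    · rw [hL.deriv]
      exact sub_eq_zero.mp h
  have hev : deriv (fun z => log (Z z)) =ᶠ[𝓝 (0 : ℂ)] deriv T := by
    filter_upwards [isOpen_ball.mem_nhds (mem_ball_self hspos)] with w hw
    exact hderiv w hw
  obtain ⟨k, rfl⟩ := Nat.exists_eq_add_of_le' hn
  rw [iteratedDeriv_succ', iteratedDeriv_succ']
  exact hev.iteratedDeriv_eq k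

end Continuation

/-! ### The sourced torus: zero-free complex source disc and cumulant bounds at fixed temperature -/

section Model

variable (β μ : ℝ)

/-- **Zero-free complex source disc and cumulants of the interacting torus at fixed temperature.** For `β ≥ 0`,
`μ` there are `δ > 0`, `ϱ > 0` with `ϱδ ≤ 1/3` and `A ≥ 0` such that for every `L ≥ 3` and real `|U| ≤ δ`, with
`Z_L(U,z) = Tr e^{-β(hubbardTorusWith 2 L 1 U μ - z(Δ_d + Δ_d†))}`:
(i) `Z_L(U,z) ≠ 0` for all complex `‖z‖ < 2δ`;
(ii) `‖(m!)⁻¹ (log Z_L(U,·))⁽ᵐ⁾(0)‖ ≤ (3/2)L²Aϱ^m` for `m ≥ 1`;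
(iii) `‖(m!)⁻¹ (log Z_L(U,·))⁽ᵐ⁾(0) - (m!)⁻¹ (log Z_L(0,·))⁽ᵐ⁾(0)‖ ≤ (3/2)L²Aϱ^{m+1}|U|` for `m ≥ 1`.
[cite: Ruelle1969, §4.4] -/
theorem dWaveSourceTorus_complexSourceDisc (hβ : 0 ≤ β) :
    ∃ δ : ℝ, 0 < δ ∧ ∃ ϱ : ℝ, 0 < ϱ ∧ ϱ * δ ≤ 1 / 3 ∧ ∃ A : ℝ, 0 ≤ A ∧ ∀ (L : ℕ) [NeZero L], 3 ≤ L →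
      ∀ U : ℝ, |U| ≤ δ →
        (∀ z : ℂ, ‖z‖ < 2 * δ →
          Matrix.partitionFn β (hubbardTorusWith 2 L 1 U μ -
            z • (pairField dWaveFormFactor L + (pairField dWaveFormFactor L)ᴴ)) ≠ 0) ∧
        (∀ m : ℕ, 1 ≤ m →
          ‖((m ! : ℂ))⁻¹ * iteratedDeriv m (fun z : ℂ => log (Matrix.partitionFn β (hubbardTorusWith 2 L 1 U μ -
            z • (pairField dWaveFormFactor L + (pairField dWaveFormFactor L)ᴴ)))) 0‖ ≤
            3 / 2 * ((L : ℝ) ^ 2 * A) * ϱ ^ m) ∧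
        (∀ m : ℕ, 1 ≤ m →
          ‖((m ! : ℂ))⁻¹ * iteratedDeriv m (fun z : ℂ => log (Matrix.partitionFn β (hubbardTorusWith 2 L 1 U μ -
              z • (pairField dWaveFormFactor L + (pairField dWaveFormFactor L)ᴴ)))) 0 -
            ((m ! : ℂ))⁻¹ * iteratedDeriv m (fun z : ℂ => log (Matrix.partitionFn β (hubbardTorusWith 2 L 1 0 μ -
              z • (pairField dWaveFormFactor L + (pairField dWaveFormFactor L)ᴴ)))) 0‖ ≤
            3 / 2 * ((L : ℝ) ^ 2 * A) * ϱ ^ (m + 1) * |U|) := by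
  obtain ⟨δ, hδ, ϱ, hϱ, hϱδ, A, hA, hmain⟩ := dWaveSourceTorus_partitionFn_eq_exp_sourcePowerSeries β μ hβ
  refine ⟨δ, hδ, ϱ, hϱ, hϱδ, A, hA, ?_⟩
  intro L _ hL
  obtain ⟨Z₀, hZ₀, a, hbound, hdiff, hrep⟩ := hmain L hL
  set Q := pairField dWaveFormFactor L + (pairField dWaveFormFactor L)ᴴ with hQ
  set B : ℝ := (L : ℝ) ^ 2 * A with hB
  have hB0 : 0 ≤ B := by positivity
  have hM : ∀ {U : ℝ}, |U| ≤ δ → 0 ≤ 3 / 2 * B := fun _ => by positivity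
  have h0δ : |(0 : ℝ)| ≤ δ := by rw [abs_zero]; exact hδ.le
  -- the radius `2δ` of holomorphy of the source series: `ϱ · 2δ ≤ 2/3 < 1`
  have h2δ : ϱ * (2 * δ) < 1 := by nlinarith
  -- per `U`: entire `Z`, the series `T_U`, the identity theorem, the Taylor coefficients
  have perU : ∀ U : ℝ, |U| ≤ δ →
      EqOn (fun z : ℂ => Matrix.partitionFn β (hubbardTorusWith 2 L 1 U μ - z • Q))
        (fun z => (Z₀ : ℂ) * exp (∑' m, a U m * z ^ m)) (ball (0 : ℂ) (2 * δ)) ∧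
      ∀ m : ℕ, 1 ≤ m → ((m ! : ℂ))⁻¹ *
        iteratedDeriv m (fun z : ℂ => log (Matrix.partitionFn β (hubbardTorusWith 2 L 1 U μ - z • Q))) 0 = a U m := by
    intro U hU
    have hZd : Differentiable ℂ fun z : ℂ => Matrix.partitionFn β (hubbardTorusWith 2 L 1 U μ - z • Q) :=
      differentiable_partitionFn_sub_smul β _ Q
    have hTd : DifferentiableOn ℂ (fun z : ℂ => ∑' m, a U m * z ^ m) (ball (0 : ℂ) (2 * δ)) :=
      differentiableOn_tsum_mul_pow (hM hU) hϱ.le (hbound U hU) (by positivity) h2δ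
    have hreal : ∀ t : ℝ, |t| ≤ δ → Matrix.partitionFn β (hubbardTorusWith 2 L 1 U μ - (t : ℂ) • Q) =
        (Z₀ : ℂ) * exp (∑' m, a U m * (t : ℂ) ^ m) := fun t ht => (hrep U t hU ht).2
    have heq := eqOn_mul_cexp_of_real_eq hZd hTd (by positivity) hδ hreal
    refine ⟨heq, fun m hm => ?_⟩
    have hslit : Matrix.partitionFn β (hubbardTorusWith 2 L 1 U μ - (0 : ℂ) • Q) ∈ slitPlane := by
      rw [zero_smul, sub_zero]
      exact partitionFn_mem_slitPlane β (isHermitian_hamiltonianWith (fermionTorusGraph 2 L) 1 U μ)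
    have hT := iteratedDeriv_clog_eq_of_eqOn_mul_cexp hZd hslit hTd (by positivity) heq hm
    rw [hT, iteratedDeriv_tsum_mul_pow_zero (hM hU) hϱ (hbound U hU) m, ← mul_assoc,
      inv_mul_cancel₀ (by exact_mod_cast m.factorial_ne_zero), one_mul]
  intro U hU
  obtain ⟨heqU, hcoefU⟩ := perU U hU
  obtain ⟨-, hcoef0⟩ := perU 0 h0δ
  refine ⟨fun z hz => ?_, fun m hm => ?_, fun m hm => ?_⟩
  · -- (i) zero-freeness on `‖z‖ < 2δ`
    have := heqU (mem_ball_zero_iff.mpr hz)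
    simp only at this
    rw [this]
    exact mul_ne_zero (by exact_mod_cast hZ₀.ne') (exp_ne_zero _)
  · -- (ii)
    rw [hcoefU m hm]
    exact hbound U hU m
  · -- (iii)
    rw [hcoefU m hm, hcoef0 m hm]
    exact hdiff U hU m

/-- **Fixed-temperature calibration of the pair-cumulant hypothesis (K).** For `β ≥ 1`, `μ` there are
`δ, A', B' > 0` such that for all `L ≥ 3`, real `|U| ≤ δ` and `m ≥ 2`:
`‖(m!)⁻¹ (log Z_L(U,·))⁽ᵐ⁾(0)‖ ≤ A'(1 + log β)(βL²)(B'β)^{m-2}` — the shape of hypothesis (K) of the route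
ThermalWedge's `twThermalDisc_of_pairCumulantBound`, here with `β`-DEPENDENT constants (single scale).
[cite: Ruelle1969, §4.4] -/
theorem dWaveSourceTorus_pairCumulantBound_fixedT (hβ : 1 ≤ β) :
    ∃ δ A' B' : ℝ, 0 < δ ∧ 0 < A' ∧ 0 < B' ∧ ∀ (L : ℕ) [NeZero L], 3 ≤ L → ∀ U : ℝ, |U| ≤ δ →
      ∀ m : ℕ, 2 ≤ m →
        ‖((m ! : ℂ))⁻¹ * iteratedDeriv m (fun z : ℂ => log (Matrix.partitionFn β (hubbardTorusWith 2 L 1 U μ -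
            z • (pairField dWaveFormFactor L + (pairField dWaveFormFactor L)ᴴ)))) 0‖ ≤
          A' * (1 + Real.log β) * (β * (L : ℝ) ^ 2) * (B' * β) ^ (m - 2) := by
  have hβ0 : 0 < β := by linarith
  obtain ⟨δ, hδ, ϱ, hϱ, -, A, hA, hmain⟩ := dWaveSourceTorus_complexSourceDisc β μ hβ0.le
  refine ⟨δ, 3 / 2 * (A + 1) * ϱ ^ 2 / β, ϱ / β, hδ, by positivity, by positivity, ?_⟩
  intro L _ hL U hU m hm
  obtain ⟨-, hcoef, -⟩ := hmain L hL U hU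
  have hlog : 1 ≤ 1 + Real.log β := by have := Real.log_nonneg hβ; linarith
  have hL2 : 0 ≤ (L : ℝ) ^ 2 := by positivity
  calc _ ≤ 3 / 2 * ((L : ℝ) ^ 2 * A) * ϱ ^ m := hcoef m (by omega)
    _ ≤ 3 / 2 * ((L : ℝ) ^ 2 * (A + 1)) * ϱ ^ m := by gcongr; linarith
    _ = 3 / 2 * (A + 1) * ϱ ^ 2 / β * 1 * (β * (L : ℝ) ^ 2) * (ϱ / β * β) ^ (m - 2) := by
        have hm2 : m = (m - 2) + 2 := by omega
        rw [div_mul_cancel₀ ϱ hβ0.ne']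
        conv_lhs => rw [hm2, pow_add]
        field_simp
    _ ≤ 3 / 2 * (A + 1) * ϱ ^ 2 / β * (1 + Real.log β) * (β * (L : ℝ) ^ 2) * (ϱ / β * β) ^ (m - 2) := by
        gcongr

end Model

end Literature.MathematicalPhysics.QuantumLattice
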